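import Mathlib
import Summits.ValiantsHypothesis.ValiantsHypothesis.Theses.NewtonUnitEquations
import Summits.ValiantsHypothesis.ValiantsHypothesis.Theorems.NewtonUnitEquationsDissociatedUniformZerosLogK
import Summits.ValiantsHypothesis.ValiantsHypothesis.Theorems.NewtonUnitEquationsDissociatedUniformShadowVertices

/-!
# Crux `NewtonUnitEquations.DissociatedUniform` (stmt-ValiantsHypothesis-5905) FROM the kernel `SmallShadow`,
# as a tree theorem (line `greedy-basis-shadow`, skeleton v5 composition, sorry-free and `t`-general)

The registered kernel stub `stub_smallShadow` of `Cruxes/DissociatedUniform/Lines/greedy_basis_shadow.lean` reads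

  `∃ P, ∀ k n A f, n ≤ 4k² → (∀ j, |A j| ≤ 4k² + 1) → |QuasiPoly.fshadow A f| ≤ (k + 2)^P`.

This file proves, WITHOUT that stub (it is taken as an explicit hypothesis, verbatim), the composition of the line:

* `OfSmallShadow.ncard_fshadow_le_of_smallBound`: any uniform bound `Q` on the shadows of the `k`-product frames with
  `≤ 4k²` coordinates and `≤ 4k² + 1` letters gives `|fshadow A f| ≤ 2(((m t²)² + 1)·k·Q + (m t²)²·k) + 2k + 1` for EVERY
  frame with `≤ t` letters per coordinate (cells `CellDecomposition.ncard_pencil_le` and charts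
  `QuasiPoly.ncard_cshadow_le_charts` summed over the per-cell kernel reduction `zeros_perCell_of_bound` of lead c7;
  this is `ZerosLogK.ncard_fshadow_le` with Theorem Q's constant replaced by the abstract `Q`).
* `OfSmallShadow.vertices_le_of_smallBound`: hence the same bound for the vertices of `Newt(Σ_i Π_j f_ij)` on dissociated
  frames (`QuasiPoly.extremePoints_subset_image_fshadow`).
* `OfSmallShadow.cruxShape_of_smallShadow`: with `Q = (k+2)^P` the crux's shape `#vert ≤ (k·m·t + 2)^(P + 8)`.
* `dissociatedUniform_of_smallShadow`: `SmallShadow → Theses.NewtonUnitEquations.DissociatedUniform`.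
* `dissociatedUniform_of_pencilVertexBound`: the same from the PENCIL-VERTEX form of the kernel
  (`ShadowVertices.smallShadow_iff_pencilVertices`): a polynomial bound, uniform over the coefficient pencil
  `φ ∈ ℂ^k`, for the Newton-polygon vertices of `Σ_i φ_i Π_j f_ij` on dissociated frames with `≤ 4k²` coordinates and
  `≤ 4k² + 1` letters per coordinate implies the crux for all `(k, m, t)`.
So closing the crux through this line amounts to proving either hypothesis; both are stated here by value so that a proof
of the kernel closes the item by `dissociatedUniform_of_smallShadow h`.
-/

set_option linter.dupNamespace false

noncomputable section

open scoped BigOperators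

namespace Summit.ValiantsHypothesis.ValiantsHypothesis.Theorems.NewtonUnitEquationsDissociatedUniform

namespace OfSmallShadow

/-- **Shadow bound for all frames from a small-frame bound.**  If every `k`-product frame with `≤ 4k²` coordinates and
`≤ 4k² + 1` letters per coordinate has `|fshadow| ≤ Q`, then every `k`-product frame with `≤ t` letters per coordinate
has `|fshadow A f| ≤ 2(((m t²)² + 1)·k·Q + (m t²)²·k) + 2k + 1`. -/
theorem ncard_fshadow_le_of_smallBound (k m t Q : ℕ) (A : Fin m → Finset (Fin 2 →₀ ℕ))
    (f : Fin k → Fin m → MvPolynomial (Fin 2) ℂ)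
    (hQ : ∀ n : ℕ, n ≤ 4 * k ^ 2 → ∀ (A' : Fin n → Finset (Fin 2 →₀ ℕ)) (f' : Fin k → Fin n → MvPolynomial (Fin 2) ℂ),
      (∀ i, (A' i).card ≤ 4 * k ^ 2 + 1) → (QuasiPoly.fshadow A' f').ncard ≤ Q)
    (hcard : ∀ j, (A j).card ≤ t) :
    (QuasiPoly.fshadow A f).ncard ≤ 2 * (((m * t ^ 2) ^ 2 + 1) * (k * Q) + (m * t ^ 2) ^ 2 * k) + k + k + 1 := by
  -- adapted from `ZerosLogK.ncard_fshadow_le` (Theorem Q's constant replaced by the abstract bound `Q`)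
  have hchart : ∀ ε : ℝ, ∀ u : (Fin m → (Fin 2 →₀ ℕ)) → ℝ, (∀ a, u a = ε * QuasiPoly.Xf a) →
      (QuasiPoly.chartShadow (Fintype.piFinset A) (QuasiPoly.col f) u QuasiPoly.Yf).ncard ≤
        ((m * t ^ 2) ^ 2 + 1) * (k * Q) + (m * t ^ 2) ^ 2 * k := by
    intro ε u hu
    have hH : ∀ lam : ℝ, (fun e : Fin m → (Fin 2 →₀ ℕ) => u e + lam * QuasiPoly.Yf e) =
        fun a : Fin m → (Fin 2 →₀ ℕ) => ε * QuasiPoly.Xf a + lam * QuasiPoly.Yf a := by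
      intro lam
      funext a
      rw [hu]
    exact le_trans
      (Set.ncard_le_ncard
        (CellDecomposition.chartShadow_subset_pencil (Fintype.piFinset A) (QuasiPoly.col f) u QuasiPoly.Yf
          (fun (lam : ℝ) (a : Fin m → (Fin 2 →₀ ℕ)) => ε * QuasiPoly.Xf a + lam * QuasiPoly.Yf a) hH)
        (CellDecomposition.pencil_finite _ _ _))
      (CellDecomposition.ncard_pencil_le (Fintype.piFinset A) (QuasiPoly.col f)
        (fun (lam : ℝ) (a : Fin m → (Fin 2 →₀ ℕ)) => ε * QuasiPoly.Xf a + lam * QuasiPoly.Yf a) A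
        (fun l : Fin 2 →₀ ℕ => ((l 0 : ℕ) : ℝ)) (fun l : Fin 2 →₀ ℕ => ((l 1 : ℕ) : ℝ)) ε (k * Q) t hcard
        (fun Λ hc => zeros_perCell_of_bound k m Q A f ε Λ hQ hc))
  have hpos := hchart 1 QuasiPoly.Xf fun a => (one_mul _).symm
  have hneg := hchart (-1) (fun e => -QuasiPoly.Xf e) fun a => (neg_one_mul _).symm
  have hdec := QuasiPoly.ncard_cshadow_le_charts (Fintype.piFinset A) (QuasiPoly.col f) QuasiPoly.Xf QuasiPoly.Yf
  calc (QuasiPoly.fshadow A f).ncard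
      = (QuasiPoly.cshadow (Fintype.piFinset A) (QuasiPoly.col f) QuasiPoly.Xf QuasiPoly.Yf).ncard := rfl
    _ ≤ _ := hdec
    _ ≤ (((m * t ^ 2) ^ 2 + 1) * (k * Q) + (m * t ^ 2) ^ 2 * k) +
          (((m * t ^ 2) ^ 2 + 1) * (k * Q) + (m * t ^ 2) ^ 2 * k) + k + k + 1 := by gcongr
    _ = 2 * (((m * t ^ 2) ^ 2 + 1) * (k * Q) + (m * t ^ 2) ^ 2 * k) + k + k + 1 := by ring

/-- **Vertex bound for all dissociated frames from a small-frame shadow bound.** -/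
theorem vertices_le_of_smallBound (k m t Q : ℕ) (A : Fin m → Finset (Fin 2 →₀ ℕ))
    (f : Fin k → Fin m → MvPolynomial (Fin 2) ℂ)
    (hQ : ∀ n : ℕ, n ≤ 4 * k ^ 2 → ∀ (A' : Fin n → Finset (Fin 2 →₀ ℕ)) (f' : Fin k → Fin n → MvPolynomial (Fin 2) ℂ),
      (∀ i, (A' i).card ≤ 4 * k ^ 2 + 1) → (QuasiPoly.fshadow A' f').ncard ≤ Q)
    (hcard : ∀ j, (A j).card ≤ t) (hsupp : ∀ i j, (f i j).support ⊆ A j)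
    (hdis : ∀ a b : Fin m → (Fin 2 →₀ ℕ), (∀ j, a j ∈ A j) → (∀ j, b j ∈ A j) → ∑ j, a j = ∑ j, b j → a = b) :
    (Set.extremePoints ℝ (convexHull ℝ ((fun e : Fin 2 →₀ ℕ => fun i : Fin 2 => ((e i : ℕ) : ℝ)) ''
      ((∑ i, ∏ j, f i j).support : Set (Fin 2 →₀ ℕ))))).ncard ≤
      2 * (((m * t ^ 2) ^ 2 + 1) * (k * Q) + (m * t ^ 2) ^ 2 * k) + k + k + 1 :=
  calc (Set.extremePoints ℝ (convexHull ℝ ((fun e : Fin 2 →₀ ℕ => fun i : Fin 2 => ((e i : ℕ) : ℝ)) ''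
        ((∑ i, ∏ j, f i j).support : Set (Fin 2 →₀ ℕ))))).ncard
      ≤ ((fun a : Fin m → (Fin 2 →₀ ℕ) => fun i : Fin 2 => (((∑ j, a j) i : ℕ) : ℝ)) '' QuasiPoly.fshadow A f).ncard :=
        Set.ncard_le_ncard (QuasiPoly.extremePoints_subset_image_fshadow A f hsupp hdis)
          ((QuasiPoly.cshadow_finite _ _ _ _).image _)
    _ ≤ (QuasiPoly.fshadow A f).ncard := Set.ncard_image_le (QuasiPoly.cshadow_finite _ _ _ _)
    _ ≤ _ := ncard_fshadow_le_of_smallBound k m t Q A f hQ hcard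

/-- Arithmetic of the crux shape: with `x = k·m·t + 2 ≥ 3`, `k, m, t ≥ 1`,
`2(((m t²)² + 1)·k·(k+2)^P + (m t²)²·k) + 2k + 1 ≤ x^(P + 8)`. -/
theorem shape_arith (k m t P : ℕ) (hk : 1 ≤ k) (hm : 1 ≤ m) (ht : 1 ≤ t) :
    2 * (((m * t ^ 2) ^ 2 + 1) * (k * (k + 2) ^ P) + (m * t ^ 2) ^ 2 * k) + k + k + 1 ≤
      (k * m * t + 2) ^ (P + 8) := by
  set x := k * m * t + 2 with hx
  have hkmt : 1 ≤ k * m * t := Nat.mul_pos (Nat.mul_pos hk hm) ht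
  have hx3 : 3 ≤ x := by omega
  have hx1 : 1 ≤ x := by omega
  have hkx : k + 2 ≤ x := by
    have : k ≤ k * m * t := by
      calc k = k * 1 * 1 := by ring
        _ ≤ k * m * t := Nat.mul_le_mul (Nat.mul_le_mul le_rfl hm) ht
    omega
  have hmt : m * t ^ 2 ≤ x ^ 2 := by
    have h1 : m * t ≤ k * m * t := by
      calc m * t = 1 * m * t := by ring
        _ ≤ k * m * t := Nat.mul_le_mul (Nat.mul_le_mul hk le_rfl) le_rfl
    have h2 : t ≤ k * m * t := by
      calc t = 1 * 1 * t := by ring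
        _ ≤ k * m * t := Nat.mul_le_mul (Nat.mul_le_mul hk hm) le_rfl
    calc m * t ^ 2 = (m * t) * t := by ring
      _ ≤ (k * m * t) * (k * m * t) := Nat.mul_le_mul h1 h2
      _ ≤ x * x := Nat.mul_le_mul (by omega) (by omega)
      _ = x ^ 2 := by ring
  have hkQ : k * (k + 2) ^ P ≤ x ^ (P + 1) := by
    calc k * (k + 2) ^ P ≤ x * x ^ P := Nat.mul_le_mul (by omega) (Nat.pow_le_pow_left hkx P)
      _ = x ^ (P + 1) := by ring
  have hA1 : (m * t ^ 2) ^ 2 + 1 ≤ x ^ 5 := by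
    have : (m * t ^ 2) ^ 2 ≤ x ^ 4 := by
      calc (m * t ^ 2) ^ 2 ≤ (x ^ 2) ^ 2 := Nat.pow_le_pow_left hmt 2
        _ = x ^ 4 := by ring
    have hx4 : 1 ≤ x ^ 4 := Nat.one_le_pow _ _ (by omega)
    calc (m * t ^ 2) ^ 2 + 1 ≤ x ^ 4 + x ^ 4 := by omega
      _ = 2 * x ^ 4 := by ring
      _ ≤ x * x ^ 4 := Nat.mul_le_mul_right _ (by omega)
      _ = x ^ 5 := by ring
  have hA2 : (m * t ^ 2) ^ 2 * k ≤ x ^ 5 := by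
    calc (m * t ^ 2) ^ 2 * k ≤ (x ^ 2) ^ 2 * x := Nat.mul_le_mul (Nat.pow_le_pow_left hmt 2) (by omega)
      _ = x ^ 5 := by ring
  have hkk : k + k + 1 ≤ x ^ 2 := by nlinarith
  calc 2 * (((m * t ^ 2) ^ 2 + 1) * (k * (k + 2) ^ P) + (m * t ^ 2) ^ 2 * k) + k + k + 1
      ≤ 2 * (x ^ 5 * x ^ (P + 1) + x ^ 5) + x ^ 2 := by
        have := Nat.mul_le_mul hA1 hkQ
        omega
    _ ≤ 2 * (x ^ 5 * x ^ (P + 1) + x ^ 5 * x ^ (P + 1)) + x ^ 5 * x ^ (P + 1) := by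
        have h1 : x ^ 5 ≤ x ^ 5 * x ^ (P + 1) := Nat.le_mul_of_pos_right _ (Nat.pow_pos (by omega))
        have h2 : x ^ 2 ≤ x ^ 5 * x ^ (P + 1) := by
          calc x ^ 2 ≤ x ^ 5 := Nat.pow_le_pow_right hx1 (by omega)
            _ ≤ x ^ 5 * x ^ (P + 1) := h1
        omega
    _ = 5 * x ^ (P + 6) := by rw [← pow_add]; ring_nf
    _ ≤ x ^ 2 * x ^ (P + 6) := Nat.mul_le_mul_right _ (by nlinarith)
    _ = (k * m * t + 2) ^ (P + 8) := by rw [← pow_add, hx]; ring_nf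

/-- **The crux's shape from `SmallShadow`.**  If the kernel holds with exponent `P`, then on every dissociated frame
`#vert Newt(Σ_i Π_j f_ij) ≤ (k·m·t + 2)^(P + 8)`. -/
theorem cruxShape_of_smallShadow (P : ℕ)
    (hS : ∀ (k n : ℕ) (A : Fin n → Finset (Fin 2 →₀ ℕ)) (f : Fin k → Fin n → MvPolynomial (Fin 2) ℂ),
      n ≤ 4 * k ^ 2 → (∀ j, (A j).card ≤ 4 * k ^ 2 + 1) → (QuasiPoly.fshadow A f).ncard ≤ (k + 2) ^ P)
    (k m t : ℕ) (A : Fin m → Finset (Fin 2 →₀ ℕ)) (f : Fin k → Fin m → MvPolynomial (Fin 2) ℂ)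
    (hcard : ∀ j, (A j).card ≤ t) (hsupp : ∀ i j, (f i j).support ⊆ A j)
    (hdis : ∀ a b : Fin m → (Fin 2 →₀ ℕ), (∀ j, a j ∈ A j) → (∀ j, b j ∈ A j) → ∑ j, a j = ∑ j, b j → a = b) :
    (Set.extremePoints ℝ (convexHull ℝ ((fun e : Fin 2 →₀ ℕ => fun i : Fin 2 => ((e i : ℕ) : ℝ)) ''
      ((∑ i, ∏ j, f i j).support : Set (Fin 2 →₀ ℕ))))).ncard ≤ (k * m * t + 2) ^ (P + 8) := by
  classical
  have hT := vertices_le_of_smallBound k m t ((k + 2) ^ P) A f (fun n hn A' f' hA' => hS k n A' f' hn hA')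
    hcard hsupp hdis
  -- adapted from `ZerosLogK.zerosLogK_cruxShape`: the vanishing cases `k = 0`, or `t = 0 < m`
  have hzero : (∑ i, ∏ j, f i j) = 0 →
      (Set.extremePoints ℝ (convexHull ℝ ((fun e : Fin 2 →₀ ℕ => fun i : Fin 2 => ((e i : ℕ) : ℝ)) ''
        ((∑ i, ∏ j, f i j).support : Set (Fin 2 →₀ ℕ))))).ncard ≤ (k * m * t + 2) ^ (P + 8) := by
    intro h
    have hE : Set.extremePoints ℝ (convexHull ℝ ((fun e : Fin 2 →₀ ℕ => fun i : Fin 2 => ((e i : ℕ) : ℝ)) ''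
        ((∑ i, ∏ j, f i j).support : Set (Fin 2 →₀ ℕ)))) = ∅ := by
      apply Set.subset_empty_iff.mp
      intro e he
      have := extremePoints_convexHull_subset he
      simp [h] at this
    rw [hE, Set.ncard_empty]
    exact Nat.zero_le _
  rcases Nat.eq_zero_or_pos k with rfl | hk
  · exact hzero (by simp)
  rcases Nat.eq_zero_or_pos m with rfl | hm
  · -- `m = 0`: at most one support point
    have hsub : ((∑ i : Fin k, ∏ j : Fin 0, f i j).support : Set (Fin 2 →₀ ℕ)) ⊆ {0} := by
      intro e he
      have h1 : (∑ i : Fin k, ∏ j : Fin 0, f i j) = MvPolynomial.C (k : ℂ) := by simp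
      rw [Finset.mem_coe, h1, MvPolynomial.mem_support_iff, MvPolynomial.coeff_C] at he
      by_contra hne
      have h0e : (0 : Fin 2 →₀ ℕ) ≠ e := fun h => hne (by rw [← h]; exact Set.mem_singleton _)
      rw [if_neg h0e] at he
      exact he rfl
    calc _ ≤ ((fun e : Fin 2 →₀ ℕ => fun i : Fin 2 => ((e i : ℕ) : ℝ)) ''
          ((∑ i : Fin k, ∏ j : Fin 0, f i j).support : Set (Fin 2 →₀ ℕ))).ncard :=
          Set.ncard_le_ncard extremePoints_convexHull_subset ((Finset.finite_toSet _).image _)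
      _ ≤ ((∑ i : Fin k, ∏ j : Fin 0, f i j).support : Set (Fin 2 →₀ ℕ)).ncard := Set.ncard_image_le (Finset.finite_toSet _)
      _ ≤ ({0} : Set (Fin 2 →₀ ℕ)).ncard := Set.ncard_le_ncard hsub (Set.finite_singleton _)
      _ = 1 := Set.ncard_singleton _
      _ ≤ (k * 0 * t + 2) ^ (P + 8) := Nat.one_le_pow _ _ (by omega)
  rcases Nat.eq_zero_or_pos t with rfl | ht
  · apply hzero
    have hj : A ⟨0, hm⟩ = ∅ := Finset.card_eq_zero.mp (Nat.le_zero.mp (hcard ⟨0, hm⟩))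
    have hf : ∀ i, f i ⟨0, hm⟩ = 0 := by
      intro i
      have := hsupp i ⟨0, hm⟩
      rw [hj, Finset.subset_empty, MvPolynomial.support_eq_empty] at this
      exact this
    refine Finset.sum_eq_zero fun i _ => ?_
    exact Finset.prod_eq_zero (Finset.mem_univ (⟨0, hm⟩ : Fin m)) (hf i)
  exact hT.trans (shape_arith k m t P hk hm ht)

end OfSmallShadow

/-- **The crux from the kernel.**  `SmallShadow` (the registered stub `stub_smallShadow` of line `greedy-basis-shadow`,
its signature verbatim as the hypothesis) implies `NewtonUnitEquations.DissociatedUniform` (stmt-ValiantsHypothesis-5905),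
with exponent `C = P + 8`. -/
theorem dissociatedUniform_of_smallShadow
    (hS : ∃ P : ℕ, ∀ (k n : ℕ) (A : Fin n → Finset (Fin 2 →₀ ℕ)) (f : Fin k → Fin n → MvPolynomial (Fin 2) ℂ),
      n ≤ 4 * k ^ 2 → (∀ j, (A j).card ≤ 4 * k ^ 2 + 1) → (QuasiPoly.fshadow A f).ncard ≤ (k + 2) ^ P) :
    Summit.ValiantsHypothesis.ValiantsHypothesis.Theses.NewtonUnitEquations.DissociatedUniform := by
  obtain ⟨P, hP⟩ := hS
  exact ⟨P + 8, fun k m t A f hcard hsupp hdis => OfSmallShadow.cruxShape_of_smallShadow P hP k m t A f hcard hsupp hdis⟩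

/-- **The crux from the pencil-vertex form of the kernel.**  A bound `(k+2)^P`, uniform over the coefficient pencil
`φ ∈ ℂ^k`, for the number of words of the box exposed as a vertex of `Newt(Σ_i φ_i Π_j f_ij)` on dissociated
`k`-product frames with `≤ 4k²` coordinates and `≤ 4k² + 1` letters per coordinate implies
`NewtonUnitEquations.DissociatedUniform` for all `(k, m, t)` (via `ShadowVertices.smallShadow_iff_pencilVertices`). -/
theorem dissociatedUniform_of_pencilVertexBound
    (hV : ∃ P : ℕ, ∀ (k n : ℕ) (A : Fin n → Finset (Fin 2 →₀ ℕ)) (f : Fin k → Fin n → MvPolynomial (Fin 2) ℂ),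
      n ≤ 4 * k ^ 2 → (∀ j, (A j).card ≤ 4 * k ^ 2 + 1) → (∀ i j, (f i j).support ⊆ A j) →
      (∀ a b : Fin n → (Fin 2 →₀ ℕ), (∀ j, a j ∈ A j) → (∀ j, b j ∈ A j) → ∑ j, a j = ∑ j, b j → a = b) →
      {a : Fin n → (Fin 2 →₀ ℕ) | a ∈ Fintype.piFinset A ∧ ∃ φ : Fin k → ℂ,
        (fun e : Fin 2 →₀ ℕ => fun i : Fin 2 => ((e i : ℕ) : ℝ)) (∑ j, a j) ∈
          Set.extremePoints ℝ (convexHull ℝ ((fun e : Fin 2 →₀ ℕ => fun i : Fin 2 => ((e i : ℕ) : ℝ)) ''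
            ((∑ i, MvPolynomial.C (φ i) * ∏ j, f i j).support : Set (Fin 2 →₀ ℕ))))}.ncard ≤ (k + 2) ^ P) :
    Summit.ValiantsHypothesis.ValiantsHypothesis.Theses.NewtonUnitEquations.DissociatedUniform :=
  dissociatedUniform_of_smallShadow (ShadowVertices.smallShadow_iff_pencilVertices.mpr hV)

end Summit.ValiantsHypothesis.ValiantsHypothesis.Theorems.NewtonUnitEquationsDissociatedUniform

end
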